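import Summits.QuantumFields.BalabanUV.T4Continuum.Support.ShellMeasureLandauHolonomyTermsEnd
import Summits.QuantumFields.BalabanUV.T4Continuum.Support.ShellMeasureLandauWeightLocal

/-!
# `T4Continuum.ShellMeasureLandauLocalEndRay` — row S70 «END-II-loc», file 4a: file 2's three-sided local END with the
# NON-WILSON PART AS A BINDER (`𝓔`, its 𝓔-ray pair `hE`∕`hB𝓔`) instead of the defined sum of per-term functionals —
# the slot S71's LOCATED supplier (`ShellMeasureRayTermsPinnedLandau.hE_landau_chartRay_pinned`, volume-free `B𝓔`)
# fills; companion of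
# (`ShellMeasureLandauHolonomyTermsEnd.slotAC_realized_su2_landauChart_threeSided`) RE-RUN WITH PER-PLAQUETTE weight
# read-out constants `κ_w : κ → ℝ` — the slot constant `D = 2(n + β·Σ_{p∈P_w} L̄_p(0 + 4s̄_p) + 3H̄∕(Rad−1))∕(1−δ)` now
# carries `s̄_p = m_w κ_w(p) z̄`, `L̄_p = 3m_w κ_w(p) z̄∕(Rad−1)` PER PLAQUETTE, ready for S69 `slotAntiConcentration_pinned`
(cell `pub-balaban`, sub-cell `t4`, spine estimate NE7c (node U5b); NE7c ROUND-2 crew, unit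
`b2b-balaban-t4-ne7c-formalise-leaf-01` gen 6, owner table `LEAVES-NE7c-P1.md` v3.0 row S70 (CLAIM journal l.16173);
ADDITIVE — imports the chain's file (D) `ShellMeasureLandauHolonomyTermsEnd` (leaf-02 lineage) and this row's file 1
`ShellMeasureLandauWeightLocal` ONLY; the proof is (D) §3's VERBATIM with `hGW_landau_chartRay_local` in place of
`hGW_landau_chartRay`; nothing of the chain is restated or modified; [folklore]; 0 `def`, 0 `def … : Prop`, 0 sorry,
0 citations)

HONEST FRAMING.  Finite four-torus programme, rung (B)+1 only — NOT infinite volume, NOT a mass gap, NOT the Clay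
problem, NOT summit progress; (B), `BetaPertHyp`, (B^μ) not consumed.  NE7c (`T4IndicatorShell.ShellWeightBound`) is
NOT PRINTED and NOT PROVED; «NE7c ⇐ the named binders»; (M1) realized ≠ NE7c (c3).  Nothing printed is asserted: the
equation numbers LOCATE the displayed SHAPES of binders ((P2), (P4), (118)∕(121), (103), (75), (44), (46), (54)), they
are not citations.  Every binder of (D) §3 is kept VERBATIM except `κw` ∕ `hκw` ∕ `hℓw` ∕ `hsw1`, which become
per-plaquette.  WHY: owner FINDING F-ne7cp1-g30-1 (GAPS l.25103) — END-II of record is LOCALITY-BLIND (p-uniform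
letter data ⇒ `D ∝ #P_w`, volume-extensive at every live level); the per-plaquette constant is the slot through which
the pinned decay `κ_w(p) ≤ κ̄_w e^{−δ′ϖ(p)}` (S69 (B)) enters; file 3 concludes VOLUME-FREE through S69
`slotAntiConcentration_pinned`.  NOTHING in the countdown moves; NE7c NOT PROVED; spine PROVED 0∕9.  HONEST
DEPENDENCY (cell): continuum YM on T⁴ ⇐ BetaPertH ∧ nine spine estimates (0/9 proved); BetaPertH ⇐ (D1) ∧ (D4) ∧
CAP+tail; G-an2-4 gates asym, D1 and NE2/3/4.
-/

noncomputable section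

open Set Metric NormedSpace MeasureTheory Function

namespace Summit.QuantumFields.BalabanUV.T4Continuum.ShellMeasureLandauLocalEndRay

open scoped ENNReal
open Literature.MathematicalPhysics.QuantumFieldTheory.Balaban1983to89
open B11Prop6Scheme (Prop4Hyp norm_arg_lt)
open GaugeField (GaugeInvariant)
open T4ShellMeasure (SlotAntiConcentration)
open T4CubePoincare (cube)
open T4CubeChartGnomonic (SU2)
open T4CubeChartExp (expWindowDensity expFibreChart)
open T4ShellMeasureDet (blockLaw)
open T4TreeGaugeFixing (NoClosedLoop fixTo)
open ShellMeasureWilsonTrace (TraceData)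
open ShellMeasureLevelAssembly (classifier weight)
open ShellMeasureLandauHolonomy (solAt landauExp)
open ShellMeasureLandauHolonomyChart (holOf cplx hAN_landau_chartRay)
open ShellMeasureLandauHolonomyContinuity (continuousOn_landauHol_chartRay)
open ShellMeasureLandauHolonomyClamp (slotAC_realized_su2_of_levelData_cube_contOn)
open ShellMeasureLandauWeightLocal (hGW_landau_chartRay_local)

variable {𝒴 𝒴' 𝒳 𝒵 ℬ : Type*} [NormedAddCommGroup 𝒴] [NormedSpace ℂ 𝒴] [CompleteSpace 𝒴]
  [NormedAddCommGroup 𝒴'] [NormedSpace ℂ 𝒴'] [NormedAddCommGroup 𝒳] [NormedSpace ℂ 𝒳] [CompleteSpace 𝒳]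
  [NormedAddCommGroup 𝒵] [NormedSpace ℂ 𝒵] [NormedAddCommGroup ℬ] [NormedSpace ℂ ℬ]

section EndThreeRay

variable {P : Params} {j : ℕ} [DecidableEq (PBond P j)]
variable {A : Type*} [NormedRing A] [NormedAlgebra ℂ A] [CompleteSpace A] [NormOneClass A]

/-- **THE THREE-SIDED LOCAL END WITH THE NON-WILSON PART AS A BINDER** — file 2's
`slotAC_realized_su2_landauChart_threeSided_local` with the defined `(Σ_i Ef V i (Z_V y)).re` and its binders
`hEd`∕`hEb`∕`hsum`∕`hcoupE` REPLACED by an arbitrary `𝓔 V` with the 𝓔-RAY PAIR `hE`∕`hB𝓔` (the Clamp-level END's own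
shape): the slot constant reads `2(n + β Σ_p L̄_p(0 + 4s̄_p) + B𝓔)∕(1−δ)` with `B𝓔` FREE — so (D)'s extensive
`hE_landau_chartRay` (`B𝓔 = 3H̄∕(Rad−1)`) and S71's located `hE_landau_chartRay_pinned` (volume-free `B𝓔`) BOTH plug in
by name.  A junction; CONDITIONAL on every binder; nothing PRINTED is asserted; NOT Bałaban's minimiser. [folklore] -/
theorem slotAC_realized_su2_landauChart_threeSided_rayE {T : Finset (PBond P j)} (hT : NoClosedLoop T)
    (U₀ : GaugeField P j SU2) (Λ : Finset (PBond P j)) {n : ℕ} (e : ↥Λ × Fin 3 ≃ Fin n)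
    {S : ℝ} (hS : 0 < S) (hSπ : 3 * S ^ 2 < Real.pi ^ 2) (c : GaugeField P j SU2 → GaugeField P j SU2)
    {R : GaugeField P j SU2 → (↥Λ → SU2) → ℝ≥0∞} (hR : ∀ V, Measurable (R V))
    {F : GaugeField P j SU2 → ℝ≥0∞} (hF : Measurable F) (hFi : GaugeInvariant F)
    (hFw : ∀ V y, F (fixTo T U₀ (updateFinset V Λ y)) =
      ENNReal.ofReal (expWindowDensity Λ (c V) S (updateFinset (c V) Λ y)) * R V y)
    (hfin : ∀ V, ((blockLaw Λ).withDensity fun y => F (fixTo T U₀ (updateFinset V Λ y))) univ ≠ ∞)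
    {u : GaugeField P j SU2 → ℝ} (hu : Measurable u) (hui : GaugeInvariant u)
    -- level data per exterior section: trace datum, plaquette index sets, window, co-test
    (Ttr : TraceData A) (hN : 0 < Ttr.N) {ι κ : Type*} {Pu : Finset ι} (hPu : Pu.Nonempty) (Pw : Finset κ)
    (W : GaugeField P j SU2 → Set (Fin n → ℝ)) (Jco : GaugeField P j SU2 → (Fin n → ℝ) → ℝ≥0∞)
    {θ δ ρ β : ℝ}
    -- THE SCHEME DATA per exterior section (S22: (P2), (P4), (118)/(121), (103), (75), (44), scaling, (46), (54))
    (𝒢 : GaugeField P j SU2 → (𝒵 →L[ℂ] 𝒴)) (W𝒱 : GaugeField P j SU2 → 𝒴 → 𝒵) {B₀ C₄ a₃ b ε₄ : ℝ}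
    (h𝒢 : ∀ V f, ‖𝒢 V f‖ ≤ B₀ * ‖f‖) (hW : ∀ V, Prop4Hyp (W𝒱 V) C₄ a₃) (hB₀ : 0 < B₀) (hC₄ : 0 ≤ C₄)
    (hε₄ : 0 ≤ ε₄) (hdom : 2 * (ε₄ + B₀ * b) ≤ a₃) (hself : B₀ * C₄ * (ε₄ + B₀ * b) ^ 2 ≤ ε₄)
    (hcontr : 4 * B₀ * C₄ * (ε₄ + B₀ * b) < 1)
    (H₁ : GaugeField P j SU2 → (ℬ →L[ℂ] 𝒴)) (hH₁ : ∀ V B, ‖H₁ V B‖ ≤ B₀ * ‖B‖)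
    (Φ : GaugeField P j SU2 → (Fin n → ℂ) → ℬ) {rΦ : ℝ} (hΦd : ∀ V, DifferentiableOn ℂ (Φ V) (ball 0 rΦ))
    (hΦ0 : ∀ V, Φ V 0 = 0) (hΦ : ∀ V, ∀ z ∈ ball (0 : Fin n → ℂ) rΦ, ‖Φ V z‖ < b) (hSr : S < rΦ)
    (Cf : GaugeField P j SU2 → 𝒴' → 𝒳) {C₂ RC : ℝ} (hC₂ : 0 ≤ C₂)
    (hCq : ∀ V, ∀ Z : 𝒴', ‖Z‖ < RC → ‖Cf V Z‖ ≤ C₂ * ‖Z‖ ^ 2) (hCd : ∀ V, DifferentiableOn ℂ (Cf V) (ball 0 RC))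
    (ιs : GaugeField P j SU2 → (𝒴 →L[ℂ] 𝒴')) (hι : ∀ V Y, ‖ιs V Y‖ ≤ ‖Y‖)
    (Hop : GaugeField P j SU2 → (𝒳 →L[ℂ] 𝒴)) (hH : ∀ V X, ‖Hop V X‖ ≤ B₀ * ‖X‖)
    (hq : 9 * C₂ * B₀ * (ε₄ + B₀ * b) < 1) (hRC : 3 * (ε₄ + B₀ * b) ≤ RC)
    -- the classifier read-outs (7″), the weight read-outs (file (B)), the per-term functionals (LD f4)
    (ℓs : ι → List (𝒴 →L[ℂ] A)) {κr : ℝ} (hκ : 0 ≤ κr) (hℓ : ∀ p ∈ Pu, ∀ ℓ ∈ ℓs p, ∀ Y, ‖ℓ Y‖ ≤ κr * ‖Y‖)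
    {m : ℕ} (hlen : ∀ p ∈ Pu, (ℓs p).length ≤ m)
    (ℓw : κ → List (𝒴 →L[ℂ] A)) {κw : κ → ℝ} (hκw : ∀ p ∈ Pw, 0 ≤ κw p)
    (hℓw : ∀ p ∈ Pw, ∀ ℓ ∈ ℓw p, ∀ Y, ‖ℓ Y‖ ≤ κw p * ‖Y‖)
    {mw : ℕ} (hlenw : ∀ p ∈ Pw, (ℓw p).length ≤ mw)
    -- THE NON-WILSON PART AS A BINDER: any functional with its 𝓔-RAY PAIR (the slot S71's located supplier fills)
    (𝓔 : GaugeField P j SU2 → (Fin n → ℝ) → ℝ) {B𝓔 : ℝ}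
    (hE : ∀ V, ∀ x ∈ W V, ∀ c' : ℝ, 1 / 2 ≤ c' → c' ≤ 1 → 𝓔 V (c' • x) ≤ 𝓔 V x + (1 - c') * B𝓔) (hB𝓔 : 0 ≤ B𝓔)
    -- THE REAL STRUCTURE (file (A)) and the UNITARITY TYPE of the weight read-outs
    (𝓡𝒴 : AddSubgroup 𝒴) (h𝓡𝒴 : IsClosed (𝓡𝒴 : Set 𝒴)) (𝓡𝒵 : AddSubgroup 𝒵) (𝓡𝒴' : AddSubgroup 𝒴')
    (𝓡𝒳 : AddSubgroup 𝒳) (h𝓡𝒳 : IsClosed (𝓡𝒳 : Set 𝒳)) (𝓡ℬ : AddSubgroup ℬ)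
    (h𝒢r : ∀ V, ∀ f ∈ 𝓡𝒵, 𝒢 V f ∈ 𝓡𝒴) (hWr : ∀ V, ∀ Y ∈ 𝓡𝒴, W𝒱 V Y ∈ 𝓡𝒵)
    (hιr : ∀ V, ∀ Y ∈ 𝓡𝒴, ιs V Y ∈ 𝓡𝒴') (hHr : ∀ V, ∀ X ∈ 𝓡𝒳, Hop V X ∈ 𝓡𝒴)
    (hCr : ∀ V, ∀ Z ∈ 𝓡𝒴', Cf V Z ∈ 𝓡𝒳) (hH₁r : ∀ V, ∀ B ∈ 𝓡ℬ, H₁ V B ∈ 𝓡𝒴)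
    (hΦr : ∀ V, ∀ y : Fin n → ℝ, ‖y‖ ≤ S → Φ V (cplx y) ∈ 𝓡ℬ)
    (hℓr : ∀ p ∈ Pw, ∀ ℓ ∈ ℓw p, ∀ Y ∈ 𝓡𝒴, Ttr.τ (ℓ Y) = 0 ∧ ‖exp (ℓ Y)‖ ≤ 1)
    -- DICTIONARY (on the chart cube only): the block weight with the DEFINED weight words and non-Wilson term, the
    -- tested variable with the DEFINED classifier holonomies — all read-outs/terms of the SAME exponent field
    (hRdict : ∀ V, ∀ x ∈ cube n S,
      R V (expFibreChart Λ (c V) e x) = Jco V x * weight Ttr β Pw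
        (fun p => holOf (ℓw p) (fun y => landauExp (Cf V) (ιs V) (Hop V) (4 * C₂ * (ε₄ + B₀ * b) ^ 2)
          (solAt (𝒢 V) 0 (W𝒱 V) ε₄ (0 : 𝒵) (H₁ V (Φ V (cplx y))) + H₁ V (Φ V (cplx y)))))
        (𝓔 V) x)
    (hudict : ∀ V, ∀ x ∈ cube n S,
      u (fixTo T U₀ (updateFinset V Λ (expFibreChart Λ (c V) e x))) =
        classifier hPu (fun p => holOf (ℓs p) (fun y => landauExp (Cf V) (ιs V) (Hop V)
          (4 * C₂ * (ε₄ + B₀ * b) ^ 2)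
          (solAt (𝒢 V) 0 (W𝒱 V) ε₄ (0 : 𝒵) (H₁ V (Φ V (cplx y))) + H₁ V (Φ V (cplx y))))) x)
    -- SM-L5/L6: kept co-tests supported in the window, centre-monotone; the window inside the chart ball
    (hJW : ∀ V x, Jco V x ≠ 0 → x ∈ W V)
    (hJ : ∀ V x, ∀ a : ℝ, 0 ≤ a → Jco V x ≤ Jco V (Real.exp (-a) • x))
    (hWS : ∀ V, W V ⊆ closedBall (0 : Fin n → ℝ) S)
    -- numbers + the weight-side smallness `s̄ ≤ 1` + SM-L2 (SM) in the currency `Rad = r_Φ / S`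
    (hθ : 0 < θ) (hδ0 : 0 ≤ δ) (hδ1 : δ < 1) (hρ0 : 0 ≤ ρ) (hρ : ρ ≤ (1 - δ) / 2) (hβ : 0 ≤ β)
    (hsw1 : ∀ p ∈ Pw, mw * (κw p * ((ε₄ + B₀ * b) + B₀ * (4 * C₂ * (ε₄ + B₀ * b) ^ 2))) ≤ 1)
    (hSM : 36 * (Real.exp (m * (κr * ((ε₄ + B₀ * b) + B₀ * (4 * C₂ * (ε₄ + B₀ * b) ^ 2)))) - 1) * 1 ^ 2 /
      (rΦ / S - 1) ^ 2 ≤ δ * θ) :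
    SlotAntiConcentration ((fieldMeasure P j SU2).withDensity F) u θ ρ
      (2 * ((n : ℝ) + (β * ∑ p ∈ Pw,
        (mw * (3 * (κw p * ((ε₄ + B₀ * b) + B₀ * (4 * C₂ * (ε₄ + B₀ * b) ^ 2))) / (rΦ / S - 1))) *
          (0 + 4 * (mw * (κw p * ((ε₄ + B₀ * b) + B₀ * (4 * C₂ * (ε₄ + B₀ * b) ^ 2))))) +
        B𝓔)) / (1 - δ)) := by
  have hRad : 1 < rΦ / S := by rw [lt_div_iff₀ hS]; linarith
  have hb : 0 < b := by
    obtain ⟨V⟩ : Nonempty (GaugeField P j SU2) := ⟨fun _ => 1⟩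
    exact (norm_nonneg _).trans_lt (hΦ V 0 (mem_ball_self (hS.trans hSr)))
  have hz : 0 < (ε₄ + B₀ * b) + B₀ * (4 * C₂ * (ε₄ + B₀ * b) ^ 2) := by positivity
  have hs0 : ∀ p ∈ Pw, 0 ≤ mw * (κw p * ((ε₄ + B₀ * b) + B₀ * (4 * C₂ * (ε₄ + B₀ * b) ^ 2))) :=
    fun p hp => mul_nonneg (Nat.cast_nonneg _) (mul_nonneg (hκw p hp) hz.le)
  have hL0 : ∀ p ∈ Pw, 0 ≤ mw * (3 * (κw p * ((ε₄ + B₀ * b) + B₀ * (4 * C₂ * (ε₄ + B₀ * b) ^ 2))) / (rΦ / S - 1)) :=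
    fun p hp => mul_nonneg (Nat.cast_nonneg _) (div_nonneg (mul_nonneg (by norm_num)
      (mul_nonneg (hκw p hp) hz.le)) (by linarith))
  refine slotAC_realized_su2_of_levelData_cube_contOn hT U₀ Λ e hS hSπ c hR hF hFi hFw hfin hu hui Ttr hN hPu
    (fun V p => holOf (ℓs p) (fun y => landauExp (Cf V) (ιs V) (Hop V) (4 * C₂ * (ε₄ + B₀ * b) ^ 2)
      (solAt (𝒢 V) 0 (W𝒱 V) ε₄ (0 : 𝒵) (H₁ V (Φ V (cplx y))) + H₁ V (Φ V (cplx y)))))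
    (fun V p _ => continuousOn_landauHol_chartRay hS (h𝒢 V) (hW V) hB₀ hC₄ hε₄ hdom hself hcontr (H₁ V) (hH₁ V)
      (hΦd V) (hΦ V) hSr hC₂ (hCq V) (hCd V) (ιs V) (hι V) (Hop V) (hH V) hq hRC (ℓs p))
    Pw
    (fun V p => holOf (ℓw p) (fun y => landauExp (Cf V) (ιs V) (Hop V) (4 * C₂ * (ε₄ + B₀ * b) ^ 2)
      (solAt (𝒢 V) 0 (W𝒱 V) ε₄ (0 : 𝒵) (H₁ V (Φ V (cplx y))) + H₁ V (Φ V (cplx y)))))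
    𝓔 W Jco
    (sw := fun p => mw * (κw p * ((ε₄ + B₀ * b) + B₀ * (4 * C₂ * (ε₄ + B₀ * b) ^ 2))))
    (lw := fun p => mw * (3 * (κw p * ((ε₄ + B₀ * b) + B₀ * (4 * C₂ * (ε₄ + B₀ * b) ^ 2))) / (rΦ / S - 1)))
    (dw := fun _ => 0)
    hRdict hudict hJW hJ hRad (fun V => ?_) (fun V => ?_) hsw1 hs0 hL0
    (fun _ _ => le_rfl) hE hB𝓔 hθ hδ0 hδ1 hρ0 hρ hβ hSM
  · exact hAN_landau_chartRay hS (hWS V) (h𝒢 V) (hW V) hB₀ hC₄ hε₄ hdom hself hcontr (H₁ V) (hH₁ V) (hΦd V)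
      (hΦ0 V) (hΦ V) hSr hC₂ (hCq V) (hCd V) (ιs V) (hι V) (Hop V) (hH V) hq hRC ℓs hκ hℓ hlen
  · exact hGW_landau_chartRay_local Ttr hS (hWS V) (h𝒢 V) (hW V) hB₀ hC₄ hε₄ hdom hself hcontr (H₁ V) (hH₁ V)
      (hΦd V) (hΦ0 V) (hΦ V) hSr hC₂ (hCq V) (hCd V) (ιs V) (hι V) (Hop V) (hH V) hq hRC ℓw hκw hℓw hlenw 𝓡𝒴 h𝓡𝒴
      𝓡𝒵 𝓡𝒴' 𝓡𝒳 h𝓡𝒳 𝓡ℬ (h𝒢r V) (hWr V) (hιr V) (hHr V) (hCr V) (hH₁r V) (hΦr V) hℓr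



end EndThreeRay

end Summit.QuantumFields.BalabanUV.T4Continuum.ShellMeasureLandauLocalEndRay

end
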